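import Literature.Analysis.FluidPDE.FiniteFourierModeEulerChain
import Literature.Analysis.FluidPDE.FiniteFourierModeEulerEdge
import Literature.Analysis.FluidPDE.FiniteFourierModeEulerExcess
import Literature.Analysis.FluidPDE.FiniteFourierModeEulerFacetsB

/-!
# Kishimoto–Yoneda, Prop. 4.4 (iv) / Prop. 4.7 at the vertex of maximal length, I: the chain

Support file for `FiniteFourierModeEuler` (N. Kishimoto, T. Yoneda, J. Math. Fluid Mech. 24
(2022) 74 = arXiv:2110.08039). We run the argument of Props. 4.4 (iv) and 4.7 around the boundary
polygon `q₀ = p₀, q₁, …, q_m` (`FiniteFourierModeEulerPolygonB/C`) of a two-dimensional face of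
`S^{conv}` at the vertex `p₀` of maximal length: each side is an edge of `S^{conv}`, hence its
endpoints do not interact (Lemma 4.5, `FiniteFourierModeEulerEdge`), so the closed-chain lemma of
`FiniteFourierModeEulerAngle` applies to the `(m+1)`-periodic chain and yields: `u_{p₀}·u_{p₀} = 0`,
or the frame-factor product `polyProd q m` is real (`dot_self_eq_zero_or_polyProd_real`).

## References

* [KishimotoYoneda2022] N. Kishimoto, T. Yoneda, J. Math. Fluid Mech. 24 (2022) 74 =
  arXiv:2110.08039, §4 Lemma 4.5, Lemma 4.6, Prop. 4.4 (iv), Prop. 4.7 and their proofs.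
-/

noncomputable section

open Matrix Set Finset Complex

namespace Literature.Analysis.FluidPDE

namespace KY

open scoped Classical

/-! ### Perturbing a supporting functional to expose a sub-face -/

/-- **Perturbation lemma (set version).** If `φ ≤ M` on `S` and `g ≤ G` on the contact set
`{φ = M}`, then for small `ε > 0` the functional `φ + ε g` is at most `M + ε G` on `S`, with
equality only at contact points where `g = G`. [folklore] -/
theorem exists_perturb_face {S : Finset (Fin 3 → ℝ)} {φ g : Fin 3 → ℝ} {M G : ℝ}
    (hφ : ∀ s ∈ S, φ ⬝ᵥ s ≤ M) (hg : ∀ s ∈ S, φ ⬝ᵥ s = M → g ⬝ᵥ s ≤ G) :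
    ∃ ε : ℝ, 0 < ε ∧ ∀ s ∈ S, (φ + ε • g) ⬝ᵥ s ≤ M + ε * G ∧
      ((φ + ε • g) ⬝ᵥ s = M + ε * G → φ ⬝ᵥ s = M ∧ g ⬝ᵥ s = G) := by
  set L := S.filter fun s => φ ⬝ᵥ s < M with hL
  by_cases hLne : L.Nonempty
  · obtain ⟨s₀, hs₀, hs₀max⟩ := L.exists_max_image (fun s => φ ⬝ᵥ s) hLne
    set δ := M - φ ⬝ᵥ s₀ with hδ
    have hδpos : 0 < δ := sub_pos.2 (Finset.mem_filter.1 hs₀).2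
    obtain ⟨s₁, -, hs₁max⟩ := L.exists_max_image (fun s => g ⬝ᵥ s - G) hLne
    set B := max (g ⬝ᵥ s₁ - G) 1 with hB
    have hBpos : 0 < B := lt_of_lt_of_le one_pos (le_max_right _ _)
    refine ⟨δ / (2 * B), div_pos hδpos (by positivity), fun s hs => ?_⟩
    simp only [add_dotProduct, smul_dotProduct, smul_eq_mul]
    by_cases hlt : φ ⬝ᵥ s < M
    · have hsL : s ∈ L := Finset.mem_filter.2 ⟨hs, hlt⟩
      have h1 : φ ⬝ᵥ s ≤ φ ⬝ᵥ s₀ := hs₀max s hsL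
      have h2 : g ⬝ᵥ s - G ≤ B := (hs₁max s hsL).trans (le_max_left _ _)
      have h3 : δ / (2 * B) * (g ⬝ᵥ s - G) ≤ δ / (2 * B) * B :=
        mul_le_mul_of_nonneg_left h2 (div_pos hδpos (by positivity)).le
      have h4 : δ / (2 * B) * B = δ / 2 := by field_simp
      constructor
      · nlinarith
      · intro heq; exfalso; nlinarith
    · have heq : φ ⬝ᵥ s = M := le_antisymm (hφ s hs) (not_lt.1 hlt)
      have hgs := hg s hs heq
      have hε : 0 < δ / (2 * B) := div_pos hδpos (by positivity)
      constructor
      · nlinarith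
      · intro h
        refine ⟨heq, le_antisymm hgs ?_⟩
        have : δ / (2 * B) * g ⬝ᵥ s = δ / (2 * B) * G := by linarith
        exact (mul_left_cancel₀ hε.ne' this).ge
  · refine ⟨1, one_pos, fun s hs => ?_⟩
    have heq : φ ⬝ᵥ s = M := by
      by_contra hne
      exact hLne ⟨s, Finset.mem_filter.2 ⟨hs, lt_of_le_of_ne (hφ s hs) hne⟩⟩
    have hgs := hg s hs heq
    simp only [add_dotProduct, smul_dotProduct, smul_eq_mul, one_mul]
    constructor
    · linarith
    · intro h; exact ⟨heq, by linarith⟩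

/-- Two distinct points of a plane not through the origin are linearly independent. [folklore] -/
theorem cross_ne_zero_of_level {φ a b : Fin 3 → ℝ} {M : ℝ} (hM : M ≠ 0) (ha : φ ⬝ᵥ a = M)
    (hb : φ ⬝ᵥ b = M) (hab : a ≠ b) : a ⨯₃ b ≠ 0 := by
  intro h0
  have ha0 : a ≠ 0 := by rintro rfl; rw [dotProduct_zero] at ha; exact hM ha.symm
  have hb' := eq_smul_of_cross_eq_zero ha0 (u := b) (by rw [← cross_anticomm, h0, neg_zero])
  set c := (a ⬝ᵥ b) / (a ⬝ᵥ a)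
  have : φ ⬝ᵥ b = c * M := by rw [hb', dotProduct_smul, ha, smul_eq_mul]
  rw [hb] at this
  have hc : c = 1 := by
    have h1 : M * (c - 1) = 0 := by linear_combination -this
    have := (mul_eq_zero.1 h1).resolve_left hM
    linarith
  rw [hc, one_smul] at hb'
  exact hab hb'.symm

/-! ### The sides of the boundary polygon do not interact -/

namespace IsFiniteModeEulerSolution

variable {I : Set ℝ} {S : Finset (Fin 3 → ℝ)} {u : (Fin 3 → ℝ) → ℝ → (Fin 3 → ℂ)}

/-- **Lemma 4.5 on the sides of the boundary polygon of a face.** For the face polygon at the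
vertex of maximal length, consecutive points `q_j, q_{j+1}` (`0 ≤ j ≤ m`) are the endpoints of an
edge of `S^{conv}`, hence do not interact at any time at which all modes of `S` are occupied.
[cite: KishimotoYoneda2022, §4 Lemma 4.5, Prop. 4.4 (iii)] -/
theorem nonInteracting_poly (hS : IsFiniteModeEulerSolution I S u) {t : ℝ} (ht : t ∈ I)
    (hgen : ∀ n ∈ S, u n t ≠ 0) {φ p₀ : Fin 3 → ℝ} (cfg : FaceCfg S φ p₀ 1) {j : ℕ}
    (hj : j ≤ FaceCfg.nverts S φ p₀ 1) :
    NonInteracting (FaceCfg.poly S φ p₀ 1 j) (FaceCfg.poly S φ p₀ 1 (j + 1))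
      (u (FaceCfg.poly S φ p₀ 1 j) t) (u (FaceCfg.poly S φ p₀ 1 (j + 1)) t) := by
  set a := FaceCfg.poly S φ p₀ 1 j with ha
  set b := FaceCfg.poly S φ p₀ 1 (j + 1) with hb
  obtain ⟨haF, -⟩ := cfg.poly_mem_face' (Nat.le_succ_of_le hj)
  obtain ⟨hbF, -⟩ := cfg.poly_mem_face' (Nat.succ_le_succ hj)
  obtain ⟨haS, ha1⟩ := Finset.mem_filter.1 haF
  obtain ⟨hbS, hb1⟩ := Finset.mem_filter.1 hbF
  have hab : a ≠ b := cfg.poly_ne_succ hj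
  -- the exposing functional `ψ = φ + ε g`, `g = -(a × b)`
  set g : Fin 3 → ℝ := -(a ⨯₃ b) with hg
  have hgs : ∀ s : Fin 3 → ℝ, g ⬝ᵥ s = -(a ⬝ᵥ (b ⨯₃ s)) := by
    intro s; rw [hg, neg_dotProduct, dotProduct_comm, ← FaceCfg.triple_eq_dot_cross]
  have hφle : ∀ s ∈ S, φ ⬝ᵥ s ≤ 1 := fun s hs => by rw [dotProduct_comm]; exact cfg.hmax s hs
  have hgle : ∀ s ∈ S, φ ⬝ᵥ s = 1 → g ⬝ᵥ s ≤ 0 := by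
    intro s hs hs1
    have hsF : s ∈ face S φ 1 := Finset.mem_filter.2 ⟨hs, by rw [dotProduct_comm]; exact hs1⟩
    rw [hgs]
    linarith [(cfg.edge hj hsF).1]
  obtain ⟨ε, hε, hψ⟩ := exists_perturb_face (G := 0) hφle hgle
  set ψ := φ + ε • g with hψdef
  have hga : g ⬝ᵥ a = 0 := by rw [hgs, ← cross_anticomm, dotProduct_neg, dot_self_cross]; simp
  have hgb : g ⬝ᵥ b = 0 := by rw [hgs, cross_self, dotProduct_zero, neg_zero]
  have hψa : ψ ⬝ᵥ a = 1 := by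
    rw [hψdef, add_dotProduct, smul_dotProduct, hga, smul_zero, add_zero, dotProduct_comm, ha1]
  have hψb : ψ ⬝ᵥ b = 1 := by
    rw [hψdef, add_dotProduct, smul_dotProduct, hgb, smul_zero, add_zero, dotProduct_comm, hb1]
  have hmax : ∀ s ∈ S, ψ ⬝ᵥ s ≤ ψ ⬝ᵥ a := by
    intro s hs; rw [hψa]; have := (hψ s hs).1; rw [mul_zero, add_zero] at this; exact this
  have hray : ∀ s ∈ S, ψ ⬝ᵥ s = ψ ⬝ᵥ a → ∃ θ : ℝ, 0 ≤ θ ∧ s = a + θ • (b - a) := by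
    intro s hs heq
    rw [hψa] at heq
    have h2 := (hψ s hs).2 (by rw [mul_zero, add_zero]; exact heq)
    have hsF : s ∈ face S φ 1 := Finset.mem_filter.2 ⟨hs, by rw [dotProduct_comm]; exact h2.1⟩
    have h0 : a ⬝ᵥ (b ⨯₃ s) = 0 := by have := h2.2; rw [hgs] at this; linarith
    obtain ⟨θ, hθ0, -, hθs⟩ := (cfg.edge hj hsF).2 h0
    exact ⟨θ, hθ0, hθs⟩
  have he : ψ ⬝ᵥ (b - a) = 0 := by rw [dotProduct_sub, hψa, hψb, sub_self]
  have hk : a ⨯₃ (b - a) ≠ 0 := by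
    rw [map_sub, cross_self, sub_zero]
    exact cross_ne_zero_of_level one_ne_zero (by rw [dotProduct_comm]; exact ha1)
      (by rw [dotProduct_comm]; exact hb1) hab
  have key := hS.nonInteracting_endpoint_of_exposed_ray ht hgen haS (by rw [hψa]; exact one_pos)
    hmax hray he hk one_pos (by rw [one_smul, add_sub_cancel]; exact hbS)
  rwa [one_smul, add_sub_cancel] at key

end IsFiniteModeEulerSolution

/-! ### The periodic chain around the boundary polygon -/

section Chain

variable {S : Finset (Fin 3 → ℝ)} {φ p₀ : Fin 3 → ℝ}

/-- The frame-factor product over one period of the chain is `polyProd q m`. [folklore] -/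
theorem prod_frameFactor_chain (hm : 2 ≤ FaceCfg.nverts S φ p₀ 1) :
    ∏ j ∈ Finset.range (FaceCfg.nverts S φ p₀ 1 + 1),
        frameFactor (chain S φ p₀ j) (chain S φ p₀ (j + 1)) (chain S φ p₀ (j + 2))
      = polyProd (FaceCfg.poly S φ p₀ 1) (FaceCfg.nverts S φ p₀ 1) := by
  set q := FaceCfg.poly S φ p₀ 1 with hq
  obtain ⟨k, hk⟩ : ∃ k, FaceCfg.nverts S φ p₀ 1 = k + 2 := ⟨FaceCfg.nverts S φ p₀ 1 - 2, by omega⟩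
  unfold polyProd
  rw [hk, Finset.prod_range_succ, Finset.prod_range_succ]
  -- the first `k+1` factors
  have h1 : ∏ j ∈ Finset.range (k + 1), frameFactor (chain S φ p₀ j) (chain S φ p₀ (j + 1)) (chain S φ p₀ (j + 2))
      = ∏ j ∈ Finset.Ico 1 (k + 2), frameFactor (q (j - 1)) (q j) (q (j + 1)) := by
    rw [Finset.prod_Ico_eq_prod_range, show k + 2 - 1 = k + 1 by omega]
    refine Finset.prod_congr rfl fun j hj => ?_
    rw [Finset.mem_range] at hj
    rw [chain_of_le (by omega), chain_of_le (by omega), chain_of_le (by omega)]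
    rw [show 1 + j - 1 = j by omega, show 1 + j = j + 1 by omega, show j + 1 + 1 = j + 2 by omega]
  have h2 : frameFactor (chain S φ p₀ (k + 1)) (chain S φ p₀ (k + 1 + 1)) (chain S φ p₀ (k + 1 + 2))
      = frameFactor (q (k + 2 - 1)) (q (k + 2)) (q 0) := by
    rw [chain_of_le (by omega), chain_of_le (by omega),
      show k + 1 + 2 = FaceCfg.nverts S φ p₀ 1 + 1 by omega, chain_succ_nverts,
      show k + 2 - 1 = k + 1 by omega]
  have h3 : frameFactor (chain S φ p₀ (k + 2)) (chain S φ p₀ (k + 2 + 1)) (chain S φ p₀ (k + 2 + 2))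
      = frameFactor (q (k + 2)) (q 0) (q 1) := by
    rw [chain_of_le (by omega), show k + 2 + 1 = FaceCfg.nverts S φ p₀ 1 + 1 by omega, chain_succ_nverts,
      show k + 2 + 2 = FaceCfg.nverts S φ p₀ 1 + 2 by omega, chain_nverts_add_two (by omega)]
  rw [h1, h2, h3]

end Chain

/-! ### The dichotomy at the vertex of maximal length -/

namespace IsFiniteModeEulerSolution

variable {I : Set ℝ} {S : Finset (Fin 3 → ℝ)} {u : (Fin 3 → ℝ) → ℝ → (Fin 3 → ℂ)}

/-- **Props. 4.4 (iv) / 4.7, chain step.** At a time at which all modes of `S` are occupied, for a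
two-dimensional face of `S^{conv}` at the vertex `p₀` of maximal length with boundary polygon
`q`: either `u_{p₀}·u_{p₀} = 0`, or the frame-factor product `polyProd q m` around the polygon is
real (the velocity direction returns to itself after transport around the closed chain of
non-interacting edges). [cite: KishimotoYoneda2022, §4 proofs of Prop. 4.4 (iv) and Prop. 4.7] -/
theorem dot_self_eq_zero_or_polyProd_real (hS : IsFiniteModeEulerSolution I S u) {t : ℝ}
    (ht : t ∈ I) (hgen : ∀ n ∈ S, u n t ≠ 0) {φ p₀ : Fin 3 → ℝ} (cfg : FaceCfg S φ p₀ 1) :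
    dot (u p₀ t) (u p₀ t) = 0 ∨
      (starRingEnd ℂ) (polyProd (FaceCfg.poly S φ p₀ 1) (FaceCfg.nverts S φ p₀ 1))
        = polyProd (FaceCfg.poly S φ p₀ 1) (FaceCfg.nverts S φ p₀ 1) := by
  have hm2 : 2 ≤ FaceCfg.nverts S φ p₀ 1 := cfg.two_le_nverts
  -- data along the chain
  have hmemS : ∀ j, j ≤ FaceCfg.nverts S φ p₀ 1 + 1 →
      FaceCfg.poly S φ p₀ 1 j ∈ S ∧ FaceCfg.poly S φ p₀ 1 j ⬝ᵥ φ = 1 :=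
    fun j hj => Finset.mem_filter.1 (cfg.poly_mem_face' hj).1
  have key := dot_self_eq_zero_or_conj_prod_frameFactor_eq (m := FaceCfg.nverts S φ p₀ 1 + 1)
    (v := chain S φ p₀) (u := fun j => u (chain S φ p₀ j) t) (fun j => chain_periodic j)
    (fun j => congrArg (fun n => u n t) (chain_periodic j)) ?_ ?_ ?_ ?_
  · rw [prod_frameFactor_chain hm2] at key
    have h0 : chain S φ p₀ 0 = p₀ := by rw [chain_of_le (Nat.zero_le _), FaceCfg.poly_zero]
    simpa only [h0] using key
  · -- consecutive points are independent
    intro j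
    obtain ⟨j', hj', e1, e2⟩ := chain_consecutive (S := S) (φ := φ) (p₀ := p₀) j
    rw [e1, e2]
    exact cross_ne_zero_of_level (φ := φ) one_ne_zero
      (by rw [dotProduct_comm]; exact (hmemS j' (by omega)).2)
      (by rw [dotProduct_comm]; exact (hmemS (j' + 1) (by omega)).2) (cfg.poly_ne_succ hj')
  · intro j
    obtain ⟨j', hj', e1, -⟩ := chain_consecutive (S := S) (φ := φ) (p₀ := p₀) j
    simp only [e1]
    exact hgen _ (hmemS j' (by omega)).1
  · intro j
    obtain ⟨j', hj', e1, -⟩ := chain_consecutive (S := S) (φ := φ) (p₀ := p₀) j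
    simp only [e1]
    exact hS.div_free _ (hmemS j' (by omega)).1 t ht
  · intro j
    obtain ⟨j', hj', e1, e2⟩ := chain_consecutive (S := S) (φ := φ) (p₀ := p₀) j
    simp only [e1, e2]
    exact hS.nonInteracting_poly ht hgen cfg hj'

end IsFiniteModeEulerSolution

end KY

end Literature.Analysis.FluidPDE
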